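import Summits.QuantumFields.Balaban3D.Proofs.TransportAC

/-!
# `Summit.QuantumFields.Balaban3D.Proofs.TransportDirectAC` — the (48)–(49) transport step of [Balaban1985UV3] under `AvgAC` in DIRECT fibre form:
# one hypothesis `T_k[w·χB·m₀·e^{F₀}] ≤ m₁·B` per new history instead of the factored pair (`hfibre`, `hm₁`) — lane `pub-balaban3d`, seat alpha-1
# (shape proposed by cell ym3-torus's crux-idea card `unfactored-trivial-row`, FINDING N7; needed by the PINNED mass family `MassesPAC`)

WHY.  `TransportAC.transport41_le_sum_ae_of_ac` consumes the fibre inequality FACTORED through the transported weighted old mass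
(`hfibre : T[w χB m₀ e^{F₀}] ≤ T[w m₀]·B` and `hm₁ : T[w m₀] ≤ m₁`).  At the trivial history with print's mass `m(triv) = 1` the factor `hm₁` reads
`T_k[1] ≤ 1` — exact Haar compatibility (seat finding F-α1-1), false for a merely absolutely continuous averaging — whereas print's own bound
(49) ≤ (55)·(58) at `Ω_{k+1} = T_η` is UNFACTORED (p.269, p.272 L32–33).  The proof of the lane's lemma uses the pair only through their composite;
this file states the step with the composite `hdirect : T[w χB m₀(proj h′) e^{F₀}] ≤ᵐ m₁(h′)·B(h′)` as the hypothesis (same proof, steps A–D verbatim),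
and records that the factored pair implies it.  [folklore] measure theory; nothing of [Balaban1985UV3] is asserted.

References: T. Bałaban, Commun. Math. Phys. 102 (1985) 255–275 [Balaban1985UV3] ((48)–(49) pp.267–268, (55) p.269).
-/

noncomputable section

namespace Summit.QuantumFields.Balaban3D.Proofs.TransportDirectAC

open _root_.MeasureTheory
open Literature.MathematicalPhysics.QuantumFieldTheory.Balaban1983to89
open Literature.MathematicalPhysics.QuantumFieldTheory.Balaban1983to89.AveragingRT (rnTransport rnTransport_nonneg)
open Summit.QuantumFields.Balaban3D.Carriers (AvgAC isRT_rnTransport_of_ac integrable_rnTransport measurable_rnTransport rnTransport_congr_ae)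
open Summit.QuantumFields.Balaban3D.Proofs.Transport48 (rnTransport_mono_ae rnTransport_sum_ae integrable_weight_mul)

variable {P : Params} {j : ℕ} {G : Type*} [GaugeGroup G] [MeasurableSpace G] [HaarData G]
  {avg : GaugeField P j G → GaugeField P (j + 1) G}
variable {H₀ H₁ : Type*} [Fintype H₀] [Fintype H₁]

/-- **(48)–(49) dV-a.e. UNDER `AvgAC`, DIRECT FIBRE FORM**: fine lattice `j`, old histories `H₀`, new histories `H₁` with `proj`; `ρ` integrable with
(41)_k `ρ ≤ Σ_h m₀(h)·e^{F₀(h)}` POINTWISE (`h41`; integrable summands `hint`, `m₀ ≥ 0`); step weights `w h′`, small-field factors `χB h′` in `[0,1]`,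
measurable, with some new history of full weight above `h` wherever `m₀(h) ≠ 0` (`hcover`); `B ≥ 0`; and per new history THE DIRECT FIBRE INEQUALITY
`hdirect : T[w(h′)·χB(h′)·m₀(proj h′)·e^{F₀(proj h′)}] ≤ m₁(h′)·B(h′)` dV-a.e. — the (β) content.  THEN `Tρ ≤ Σ_{h′} m₁(h′)·B(h′)` dV-a.e.
[cite: Balaban1985UV3, (48)–(49) pp.267–268] -/
theorem transport41_le_sum_ae_direct (hac : AvgAC avg)
    (proj : H₁ → H₀) (ρ : Density P j G) (hρ : Integrable ρ (fieldMeasure P j G))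
    (m₀ : H₀ → Density P j G) (F₀ : H₀ → GaugeField P j G → ℝ)
    (w χB : H₁ → Density P j G) (m₁ B : H₁ → Density P (j + 1) G)
    (h41 : ∀ U, ρ U ≤ ∑ h, m₀ h U * Real.exp (F₀ h U))
    (hint : ∀ h, Integrable (fun U => m₀ h U * Real.exp (F₀ h U)) (fieldMeasure P j G))
    (hm₀0 : ∀ h U, 0 ≤ m₀ h U)
    (hw : ∀ h', Measurable (w h')) (hw0 : ∀ h' U, 0 ≤ w h' U) (hw1 : ∀ h' U, w h' U ≤ 1)
    (hχ : ∀ h', Measurable (χB h')) (hχ0 : ∀ h' U, 0 ≤ χB h' U) (hχ1 : ∀ h' U, χB h' U ≤ 1)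
    (hcover : ∀ h U, m₀ h U ≠ 0 → ∃ h', proj h' = h ∧ (1 : ℝ) ≤ w h' U * χB h' U)
    (hdirect : ∀ h', (rnTransport avg (fun U => w h' U * χB h' U * (m₀ (proj h') U * Real.exp (F₀ (proj h') U))))
      ≤ᵐ[fieldMeasure P (j + 1) G] fun V => m₁ h' V * B h' V) :
    rnTransport avg ρ ≤ᵐ[fieldMeasure P (j + 1) G] fun V => ∑ h', m₁ h' V * B h' V := by
  classical
  set R : Density P j G := fun U => ∑ h, m₀ h U * Real.exp (F₀ h U) with hR
  set g : H₁ → Density P j G := fun h' U => w h' U * χB h' U * (m₀ (proj h') U * Real.exp (F₀ (proj h') U)) with hg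
  have hRi : Integrable R (fieldMeasure P j G) := integrable_finsetSum _ fun h _ => hint h
  have hgi : ∀ h', Integrable (g h') (fieldMeasure P j G) := fun h' =>
    integrable_weight_mul (hw h') (hχ h') (hw0 h') (hw1 h') (hχ0 h') (hχ1 h') (hint (proj h'))
  have hg0 : ∀ h' U, 0 ≤ g h' U := fun h' U =>
    mul_nonneg (mul_nonneg (hw0 h' U) (hχ0 h' U)) (mul_nonneg (hm₀0 _ U) (Real.exp_pos _).le)
  -- Step A: `Tρ ≤ T R` a.e.
  have hA : rnTransport avg ρ ≤ᵐ[fieldMeasure P (j + 1) G] rnTransport avg R := rnTransport_mono_ae hac h41 hρ hRi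
  -- Step B: `T R = Σ_h T(m₀ h e^{F₀ h})` a.e.
  have hBsum : rnTransport avg R =ᵐ[fieldMeasure P (j + 1) G]
      fun V => ∑ h, rnTransport avg (fun U => m₀ h U * Real.exp (F₀ h U)) V :=
    rnTransport_sum_ae hac Finset.univ (fun h U => m₀ h U * Real.exp (F₀ h U)) fun h _ => hint h
  -- Step C: for each old history, insert the decomposition of unity and transport
  have hC : ∀ h, rnTransport avg (fun U => m₀ h U * Real.exp (F₀ h U)) ≤ᵐ[fieldMeasure P (j + 1) G]
      rnTransport avg (fun U => ∑ h' ∈ Finset.univ.filter (fun h' => proj h' = h), g h' U) := fun h => by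
    refine rnTransport_mono_ae hac (fun U => ?_) (hint h) (integrable_finsetSum _ fun h' _ => hgi h')
    by_cases hm : m₀ h U = 0
    · rw [hm, zero_mul]; exact Finset.sum_nonneg fun h' _ => hg0 h' U
    · have hpos : 0 ≤ m₀ h U * Real.exp (F₀ h U) := mul_nonneg (hm₀0 h U) (Real.exp_pos _).le
      have hsum : ∑ h' ∈ Finset.univ.filter (fun h' => proj h' = h), g h' U
          = (∑ h' ∈ Finset.univ.filter (fun h' => proj h' = h), w h' U * χB h' U) * (m₀ h U * Real.exp (F₀ h U)) := by
        rw [Finset.sum_mul]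
        refine Finset.sum_congr rfl fun h' hh' => ?_
        rw [Finset.mem_filter] at hh'
        rw [hg]; simp only [hh'.2]
      rw [hsum]
      obtain ⟨h₁, hh₁, hone⟩ := hcover h U hm
      have hcov : (1 : ℝ) ≤ ∑ h' ∈ Finset.univ.filter (fun h' => proj h' = h), w h' U * χB h' U :=
        hone.trans (Finset.single_le_sum (f := fun h' => w h' U * χB h' U)
          (fun h' _ => mul_nonneg (hw0 h' U) (hχ0 h' U)) (Finset.mem_filter.mpr ⟨Finset.mem_univ _, hh₁⟩))
      calc m₀ h U * Real.exp (F₀ h U) = 1 * (m₀ h U * Real.exp (F₀ h U)) := (one_mul _).symm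
        _ ≤ _ := mul_le_mul_of_nonneg_right hcov hpos
  -- Step D: split the transported refined sum
  have hD : ∀ h, rnTransport avg (fun U => ∑ h' ∈ Finset.univ.filter (fun h' => proj h' = h), g h' U)
      =ᵐ[fieldMeasure P (j + 1) G] fun V => ∑ h' ∈ Finset.univ.filter (fun h' => proj h' = h), rnTransport avg (g h') V :=
    fun h => rnTransport_sum_ae hac _ g fun h' _ => hgi h'
  have hC' := ae_all_iff.mpr hC
  have hD' := ae_all_iff.mpr hD
  have hE' := ae_all_iff.mpr hdirect
  filter_upwards [hA, hBsum, hC', hD', hE'] with V hA hBsum hC hD hE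
  calc rnTransport avg ρ V ≤ rnTransport avg R V := hA
    _ = ∑ h, rnTransport avg (fun U => m₀ h U * Real.exp (F₀ h U)) V := hBsum
    _ ≤ ∑ h, ∑ h' ∈ Finset.univ.filter (fun h' => proj h' = h), rnTransport avg (g h') V :=
        Finset.sum_le_sum fun h _ => (hC h).trans (le_of_eq (hD h))
    _ ≤ ∑ h, ∑ h' ∈ Finset.univ.filter (fun h' => proj h' = h), m₁ h' V * B h' V :=
        Finset.sum_le_sum fun h _ => Finset.sum_le_sum fun h' _ => hE h'
    _ = ∑ h', m₁ h' V * B h' V := Finset.sum_fiberwise Finset.univ proj fun h' => m₁ h' V * B h' V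

omit [Fintype H₀] [Fintype H₁] in
/-- **THE FACTORED PAIR IMPLIES THE DIRECT HYPOTHESIS**: `hfibre` (`T[g(h′)] ≤ T[w·m₀(proj h′)]·B(h′)`), `hm₁` (`T[w·m₀(proj h′)] ≤ m₁(h′)`) and `B ≥ 0`
give `hdirect` — so `TransportAC.transport41_le_sum_ae_of_ac` is the special case. [folklore] -/
theorem direct_of_factored (proj : H₁ → H₀) (m₀ : H₀ → Density P j G) (F₀ : H₀ → GaugeField P j G → ℝ)
    (w χB : H₁ → Density P j G) (m₁ B : H₁ → Density P (j + 1) G) (hB : ∀ h' V, 0 ≤ B h' V)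
    (hm₁ : ∀ h', (rnTransport avg fun U => w h' U * m₀ (proj h') U) ≤ᵐ[fieldMeasure P (j + 1) G] m₁ h')
    (hfibre : ∀ h', (rnTransport avg (fun U => w h' U * χB h' U * (m₀ (proj h') U * Real.exp (F₀ (proj h') U))))
      ≤ᵐ[fieldMeasure P (j + 1) G] fun V => rnTransport avg (fun U => w h' U * m₀ (proj h') U) V * B h' V) (h' : H₁) :
    (rnTransport avg (fun U => w h' U * χB h' U * (m₀ (proj h') U * Real.exp (F₀ (proj h') U))))
      ≤ᵐ[fieldMeasure P (j + 1) G] fun V => m₁ h' V * B h' V := by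
  filter_upwards [hm₁ h', hfibre h'] with V h1 h2
  exact h2.trans (mul_le_mul_of_nonneg_right h1 (hB h' V))

end Summit.QuantumFields.Balaban3D.Proofs.TransportDirectAC

end
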